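import Summits.ValiantsHypothesis.ValiantsHypothesis.Theorems.LacunarySymmetroidMatrixDescartesCensusDoorA34RootWitness
import Summits.ValiantsHypothesis.ValiantsHypothesis.Theorems.LacunarySymmetroidMatrixDescartesCensusDoorA34Box12IIII

/-!
# `MatrixDescartes` census — DOOR A at `(3,4)`: the KERNEL LINES of a hypothetical nineteen are in general position (at most three
# roots share a kernel line)

HONEST FRAMING.  Object-search cell `pub-symmetroid`, route `LacunarySymmetroid`; beside the OPEN typed statement
`Theses.LacunarySymmetroid.DoorA34` (stmt-ValiantsHypothesis-19980, `= DoorA34 = PosRootLawAt 3 4 18`), asserted nowhere.  Part of the ROOT LAYER of a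
hypothetical `(3,4)` nineteen (`…RootRank`: rank two at every root, so the kernel of `P(r)` is a LINE `u(r)`; `…RootType`, `…RootWitness`).
For ALL supports and with NO definiteness hypothesis:

* `eval_rowPoly_eq_mulVec` — the `i`-th coordinate of `P(x) u` is the value at `x` of the four-nomial `Σ_l ((S_l u)_i) X^{d l}`;
* **`card_roots_sharing_kernel_vector_le_three`** — for a real symmetric `(3,4)` pencil with `19` distinct positive det-roots and any `u ≠ 0`, AT MOST
  THREE positive det-roots `r` have `P(r) u = 0`: otherwise the three four-nomials above vanish at four positive points, hence identically (Descartes,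
  the exponents being pairwise distinct for a nineteen), so `S_l u = 0` for every letter — but every letter of a nineteen is nonsingular
  (`det_letter_ne_zero_of_nineteen`).  So the kernel lines `u(r_k)` of the nineteen degenerate conics take at least `7` distinct values.  (Reading, not
  formalised here: a direction `c` orthogonal to `u(r_k)` makes `r_k` a root of the `10`-nomial `cᵀ adj P(x) c` of `…RootWitness`, so at most `9` of the
  `19` kernel lines lie in a common plane whenever that form is not identically zero.)

NOTHING here bounds `ζ_sym(3,4)`; `DoorA34` stays OPEN; nothing bears on `MatrixDescartes` (stmt-ValiantsHypothesis-18050) or on `VP ≠ VNP`.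
[folklore] Sparse Descartes on four-nomials + nonsingular letters; no citation is needed.
-/

-- `Summit.ValiantsHypothesis.ValiantsHypothesis.…` repeats a component by the D-0017 layout
-- (single-conjunct summit), which the `dupNamespace` linter flags; the name is mandated.
set_option linter.dupNamespace false

namespace Summit.ValiantsHypothesis.ValiantsHypothesis.Theorems.LacunarySymmetroidMatrixDescartes.Census

open Polynomial Finset
open scoped BigOperators Polynomial Matrix

/-- The `i`-th ROW FOUR-NOMIAL of the pencil against a fixed vector `u`: its value at `x` is `(P(x) u)_i`. [folklore] -/
theorem eval_rowPoly_eq_mulVec {K : ℕ} (d : Fin K → ℕ) (S : Fin K → Matrix (Fin 3) (Fin 3) ℝ) (u : Fin 3 → ℝ)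
    (i : Fin 3) (x : ℝ) :
    (∑ l, C (((S l) *ᵥ u) i) * (X : ℝ[X]) ^ d l).eval x = ((∑ l, x ^ d l • S l) *ᵥ u) i := by
  simp only [Polynomial.eval_finsetSum, Polynomial.eval_mul, Polynomial.eval_C, Polynomial.eval_pow, Polynomial.eval_X,
    Matrix.mulVec, dotProduct, Matrix.sum_apply, Matrix.smul_apply, smul_eq_mul, Finset.sum_mul]
  rw [Finset.sum_comm]
  refine Finset.sum_congr rfl fun l _ => ?_
  refine Finset.sum_congr rfl fun j _ => ?_
  ring

/-- The row four-nomial is supported on the exponents `{d l}`. [folklore] -/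
theorem support_rowPoly_subset {K : ℕ} (d : Fin K → ℕ) (c : Fin K → ℝ) :
    (∑ l, C (c l) * (X : ℝ[X]) ^ d l).support ⊆ Finset.univ.image d := by
  intro n hn
  by_contra hni
  apply (Polynomial.mem_support_iff.mp hn)
  rw [Polynomial.finsetSum_coeff]
  refine Finset.sum_eq_zero fun l _ => ?_
  rw [Polynomial.coeff_C_mul, Polynomial.coeff_X_pow, if_neg, mul_zero]
  intro h
  exact hni (Finset.mem_image.mpr ⟨l, Finset.mem_univ _, h.symm⟩)

/-- With pairwise distinct exponents, the coefficient of `X^{d l}` in the row four-nomial is `c l`. [folklore] -/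
theorem coeff_rowPoly_of_injective {K : ℕ} (d : Fin K → ℕ) (hd : Function.Injective d) (c : Fin K → ℝ) (l : Fin K) :
    (∑ l', C (c l') * (X : ℝ[X]) ^ d l').coeff (d l) = c l := by
  rw [Polynomial.finsetSum_coeff, Finset.sum_eq_single l]
  · rw [Polynomial.coeff_C_mul, Polynomial.coeff_X_pow, if_pos rfl, mul_one]
  · intro l' _ hl'
    rw [Polynomial.coeff_C_mul, Polynomial.coeff_X_pow, if_neg, mul_zero]
    exact fun h => hl' (hd h.symm)
  · intro h; exact absurd (Finset.mem_univ l) h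

/-- A four-nomial (`K` exponents) vanishing at `K` distinct positive points is the zero polynomial (sparse Descartes). [folklore] -/
theorem rowPoly_eq_zero_of_roots {K : ℕ} (d : Fin K → ℕ) (c : Fin K → ℝ) (T : Finset ℝ) (hT : ∀ r ∈ T, 0 < r)
    (hroot : ∀ r ∈ T, (∑ l, C (c l) * (X : ℝ[X]) ^ d l).eval r = 0) (hcard : K ≤ T.card) :
    (∑ l, C (c l) * (X : ℝ[X]) ^ d l) = 0 := by
  by_contra hq
  set q := ∑ l, C (c l) * (X : ℝ[X]) ^ d l with hqdef
  have h1 := Literature.Computability.AlgebraicComplexity.card_roots_toFinset_filter_pos_lt_card_support hq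
  have h2 : q.support.card ≤ K :=
    (Finset.card_le_card (support_rowPoly_subset d c)).trans (Finset.card_image_le.trans (by simp))
  have h3 : T ⊆ q.roots.toFinset.filter (0 < ·) := by
    intro r hr
    rw [Finset.mem_filter, Multiset.mem_toFinset, Polynomial.mem_roots hq]
    exact ⟨hroot r hr, hT r hr⟩
  have h4 := Finset.card_le_card h3
  omega

/-- **AT MOST THREE ROOTS OF A NINETEEN SHARE A KERNEL VECTOR.**  Let `P = Σ_l X^{d l} S_l` (real symmetric `3 × 3` letters, any support)
have `19` distinct positive det-roots, and let `u ≠ 0`.  Then at most three positive det-roots `r` satisfy `P(r) u = 0`. [folklore] -/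
theorem card_roots_sharing_kernel_vector_le_three (d : Fin 4 → ℕ) (S : Fin 4 → Matrix (Fin 3) (Fin 3) ℝ)
    (hS : ∀ l, (S l).IsSymm)
    (h19 : 19 ≤ ((Matrix.det (∑ l, ((X : ℝ[X]) ^ d l) • (S l).map C)).roots.toFinset.filter (fun t => 0 < t)).card)
    (u : Fin 3 → ℝ) (hu : u ≠ 0) (T : Finset ℝ) (hT : ∀ r ∈ T, 0 < r)
    (hker : ∀ r ∈ T, (∑ l, r ^ d l • S l) *ᵥ u = 0) : T.card ≤ 3 := by
  by_contra hc
  push Not at hc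
  -- the exponents of a nineteen are pairwise distinct
  have hinj : Function.Injective d := by
    by_contra h
    have := doorA34_on_of_not_injective d h S hS
    omega
  -- every row four-nomial vanishes identically
  have hzero : ∀ i : Fin 3, (∑ l, C (((S l) *ᵥ u) i) * (X : ℝ[X]) ^ d l) = 0 := by
    intro i
    refine rowPoly_eq_zero_of_roots d (fun l => ((S l) *ᵥ u) i) T hT (fun r hr => ?_) (by omega)
    rw [eval_rowPoly_eq_mulVec, hker r hr]
    rfl
  -- hence every letter kills `u`
  have hSu : ∀ l, (S l) *ᵥ u = 0 := by
    intro l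
    funext i
    have h := coeff_rowPoly_of_injective d hinj (fun l => ((S l) *ᵥ u) i) l
    rw [hzero i, Polynomial.coeff_zero] at h
    exact h.symm
  -- but the letters of a nineteen are nonsingular
  have hdet : (S 0).det = 0 := Matrix.exists_mulVec_eq_zero_iff.mp ⟨u, hu, hSu 0⟩
  exact det_letter_ne_zero_of_nineteen d S h19 0 hdet

end Summit.ValiantsHypothesis.ValiantsHypothesis.Theorems.LacunarySymmetroidMatrixDescartes.Census
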